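import Mathlib
import Summits.CriticalPhenomena.CardyFormulaZ2.Theorems.CardySelfRefinementDefs
import Literature.Topology.PlaneTopology.CrosscutProofs
import HarnessLib

/-!
# Boundary-layer surgery, topology brick (S3): pockets and local sides of a cross-cut

Helper file of the registered stub `stub_layerLocalModification` (the deterministic
boundary-layer surgery) of the line `monotone-product-coordinates` (crux
`stmt-CriticalPhenomena-10269`, `…Theses.CardySelfRefinement.GradientComparability`).  Step (S3)
of the layer surgery ("dead fingers") cuts the open quad `[Q]°` along a short cross-cut `β`
through the midpoint `m` of a no-room axial edge `e`, with both ends of `β` on the same side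
`∂₁Q`: the pocket cut off by `β` has closure off `∂₀Q ∪ ∂₂Q`, while the two halves of a
crossing arc through `m` leave `m` on the two different sides of `β`; so `e` lies on no crossing.
This file proves the cross-cut topology behind that step, for a general Jordan domain `D`
(`Literature.Probability.RandomPlanarGeometry.JordanDomain`) and a cross-cut `L` of `D` from
`boundary s` to `boundary t` (`s < t < s + 1`), on top of Newman's cross-cut theorem of the
tree (`Newman1939_crosscut_holds`: `D ∖ L = U₁ ⊔ U₂`, `∂U₁ = L ∪ boundary [s,t]`,
`∂U₂ = L ∪ boundary [t,s+1]`):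

* **pockets**: the closure of `U₁` misses the open boundary arc `boundary (t, s+1)` and the
  closure of `U₂` misses `boundary (s, t)` (`crosscut_sides_and_pockets`, registered helper,
  clauses 9–10);
* **local two-sidedness of the cross-cut**: if a neighbourhood `V` of a point `m ∈ L` satisfies
  `V ∖ L ⊆ P ∪ P'` with `P, P'` preconnected subsets of `D ∖ L`, then `P ⊆ U₁, P' ⊆ U₂` or
  `P ⊆ U₂, P' ⊆ U₁` (clause 11; both `U₁` and `U₂` accumulate at `m`).

No percolation, no named fact.
-/

noncomputable section

namespace Summit.CriticalPhenomena.CardyFormulaZ2.Theorems.CardySelfRefinement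

open scoped Topology
open Filter Set MeasureTheory
open Literature.Probability.LatticeModels Literature.Probability.Percolation
open Literature.Probability.Percolation.QuadCrossing
open Summit.CriticalPhenomena.CardyFormulaZ2.Theses.CardySelfRefinement
open Literature.Topology.PlaneTopology Literature.Probability.RandomPlanarGeometry

/-- **Two open disjoint sets accumulating at a point are locally on both sides.**  If `m` lies
in the frontier of both `U₁` and `U₂` (open, disjoint, inside `S`), a neighbourhood `V` of `m`
has `V ∩ S ⊆ P ∪ P'` with `P, P'` preconnected subsets of `U₁ ∪ U₂`, then `P ⊆ U₁, P' ⊆ U₂`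
or `P ⊆ U₂, P' ⊆ U₁`. -/
theorem twoSided_of_mem_frontier {U₁ U₂ S V P P' : Set ℂ} {m : ℂ} (h₁o : IsOpen U₁)
    (h₂o : IsOpen U₂) (hdisj : Disjoint U₁ U₂) (h₁S : U₁ ⊆ S) (h₂S : U₂ ⊆ S)
    (hm₁ : m ∈ frontier U₁) (hm₂ : m ∈ frontier U₂) (hV : V ∈ 𝓝 m) (hVPP : V ∩ S ⊆ P ∪ P')
    (hP : IsPreconnected P) (hP' : IsPreconnected P') (hPS : P ⊆ U₁ ∪ U₂)
    (hP'S : P' ⊆ U₁ ∪ U₂) : (P ⊆ U₁ ∧ P' ⊆ U₂) ∨ (P ⊆ U₂ ∧ P' ⊆ U₁) := by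
  -- each `U_i` meets `P ∪ P'`
  have hmeet : ∀ W : Set ℂ, m ∈ frontier W → W ⊆ S → (W ∩ (P ∪ P')).Nonempty := by
    intro W hW hWS
    obtain ⟨y, hyV, hyW⟩ := mem_closure_iff_nhds.1 (frontier_subset_closure hW) V hV
    exact ⟨y, hyW, hVPP ⟨hyV, hWS hyW⟩⟩
  have key : ∀ {A B : Set ℂ}, A ⊆ U₁ ∪ U₂ → B ⊆ U₁ ∪ U₂ → (P ∪ P') ⊆ A ∪ B →
      ¬ (A ⊆ U₁ ∧ B ⊆ U₁) := by
    intro A B _ _ hAB ⟨hA, hB⟩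
    obtain ⟨y, hy₂, hy⟩ := hmeet U₂ hm₂ h₂S
    have hy₁ : y ∈ U₁ := by
      rcases hAB hy with h | h
      exacts [hA h, hB h]
    exact Set.disjoint_left.1 hdisj hy₁ hy₂
  have key' : ∀ {A B : Set ℂ}, (P ∪ P') ⊆ A ∪ B → ¬ (A ⊆ U₂ ∧ B ⊆ U₂) := by
    intro A B hAB ⟨hA, hB⟩
    obtain ⟨y, hy₁, hy⟩ := hmeet U₁ hm₁ h₁S
    have hy₂ : y ∈ U₂ := by
      rcases hAB hy with h | h
      exacts [hA h, hB h]
    exact Set.disjoint_left.1 hdisj hy₁ hy₂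
  rcases hP.subset_or_subset h₁o h₂o hdisj hPS with hP₁ | hP₂ <;>
    rcases hP'.subset_or_subset h₁o h₂o hdisj hP'S with hP'₁ | hP'₂
  · exact absurd ⟨hP₁, hP'₁⟩ (key hPS hP'S Subset.rfl)
  · exact Or.inl ⟨hP₁, hP'₂⟩
  · exact Or.inr ⟨hP₂, hP'₁⟩
  · exact absurd ⟨hP₂, hP'₂⟩ (key' Subset.rfl)

/-- **Cross-cut of a Jordan domain: Newman's two sides, their pockets, and local
two-sidedness** (brick (S3) of the boundary-layer surgery `stub_layerLocalModification`;
registered helper).  For a cross-cut `L` of the Jordan domain `D` from `boundary s` to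
`boundary t` (`s < t < s + 1`): `D ∖ L = U₁ ⊔ U₂` with `U₁, U₂` open connected,
`∂U₁ = L ∪ boundary [s, t]`, `∂U₂ = L ∪ boundary [t, s + 1]` (Newman); the closure of `U₁`
misses the open arc `boundary (t, s + 1)` and that of `U₂` misses `boundary (s, t)`; and for
`m ∈ L`, a neighbourhood `V` of `m` with `V ∖ L ⊆ P ∪ P'`, `P, P'` preconnected in `D ∖ L`,
forces `P ⊆ U₁, P' ⊆ U₂` or `P ⊆ U₂, P' ⊆ U₁`. -/
theorem crosscut_sides_and_pockets : ∀ (D : Literature.Probability.RandomPlanarGeometry.JordanDomain) (L : Set ℂ) (s t : ℝ), s < t → t < s + 1 → D.IsCrosscut L (D.boundary s) (D.boundary t) → ∃ U₁ U₂ : Set ℂ, IsOpen U₁ ∧ IsOpen U₂ ∧ IsConnected U₁ ∧ IsConnected U₂ ∧ Disjoint U₁ U₂ ∧ U₁ ∪ U₂ = D.carrier \ L ∧ frontier U₁ = L ∪ D.boundary '' Set.Icc s t ∧ frontier U₂ = L ∪ D.boundary '' Set.Icc t (s + 1) ∧ (∀ u ∈ Set.Ioo t (s + 1), D.boundary u ∉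 closure U₁) ∧ (∀ u ∈ Set.Ioo s t, D.boundary u ∉ closure U₂) ∧ ∀ m ∈ L, ∀ V ∈ 𝓝 m, ∀ P P' : Set ℂ, V \ L ⊆ P ∪ P' → IsPreconnected P → IsPreconnected P' → P ⊆ D.carrier \ L → P' ⊆ D.carrier \ L → (P ⊆ U₁ ∧ P' ⊆ U₂) ∨ (P ⊆ U₂ ∧ P' ⊆ U₁) := by
  intro D L s t hst hts hL
  obtain ⟨U₁, U₂, h₁o, h₂o, h₁c, h₂c, hdisj, hunion, hf₁, hf₂⟩ :=
    Newman1939_crosscut_holds D L s t hst hts hL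
  obtain ⟨hLarc, -, -, hab, hLD⟩ := hL
  have h₁D : U₁ ⊆ D.carrier := fun z hz => ((hunion ▸ Or.inl hz : z ∈ D.carrier \ L)).1
  have h₂D : U₂ ⊆ D.carrier := fun z hz => ((hunion ▸ Or.inr hz : z ∈ D.carrier \ L)).1
  -- boundary points are off the domain, hence off `U₁`, `U₂` and `L ∖ {a, b}`
  have hbdry : ∀ u : ℝ, D.boundary u ∉ D.carrier := fun u hu =>
    Set.disjoint_left.1 D.disjoint_carrier_frontier hu (D.boundary_mem_frontier u)
  have hinj := D.injOn_boundary_Ico s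
  have hmemL : ∀ u : ℝ, D.boundary u ∈ L → D.boundary u = D.boundary s ∨
      D.boundary u = D.boundary t := by
    intro u hu
    by_contra hne
    push Not at hne
    exact hbdry u (hLD ⟨hu, by simpa using hne⟩)
  refine ⟨U₁, U₂, h₁o, h₂o, h₁c, h₂c, hdisj, hunion, hf₁, hf₂, ?_, ?_, ?_⟩
  · -- the pocket `U₁` stays away from the open arc `boundary (t, s + 1)`
    intro u hu hcl
    have huI : u ∈ Ico s (s + 1) := ⟨by linarith [hu.1], hu.2⟩
    rw [closure_eq_self_union_frontier, hf₁] at hcl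
    rcases hcl with h | h | ⟨u', hu', heq⟩
    · exact hbdry u (h₁D h)
    · rcases hmemL u h with h' | h'
      · have := hinj huI ⟨le_rfl, by linarith⟩ h'
        linarith [hu.1]
      · have := hinj huI ⟨hst.le, hts⟩ h'
        linarith [hu.1]
    · have := hinj ⟨hu'.1, by linarith [hu'.2]⟩ huI heq
      linarith [hu'.2, hu.1]
  · -- the pocket `U₂` stays away from the open arc `boundary (s, t)`
    intro u hu hcl
    have huI : u ∈ Ico s (s + 1) := ⟨hu.1.le, by linarith [hu.2]⟩
    rw [closure_eq_self_union_frontier, hf₂] at hcl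
    rcases hcl with h | h | ⟨u', hu', heq⟩
    · exact hbdry u (h₂D h)
    · rcases hmemL u h with h' | h'
      · have := hinj huI ⟨le_rfl, by linarith⟩ h'
        linarith [hu.1]
      · have := hinj huI ⟨hst.le, hts⟩ h'
        linarith [hu.2]
    · rcases hu'.2.lt_or_eq with hlt | heq'
      · have := hinj ⟨by linarith [hu'.1], hlt⟩ huI heq
        linarith [hu'.1, hu.2]
      · rw [heq', D.periodic_boundary] at heq
        have := hinj ⟨le_rfl, by linarith⟩ huI heq
        linarith [hu.1]
  · -- local two-sidedness at a point of the cross-cut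
    intro m hm V hV P P' hVPP hP hP' hPS hP'S
    have hm₁ : m ∈ frontier U₁ := hf₁ ▸ Or.inl hm
    have hm₂ : m ∈ frontier U₂ := hf₂ ▸ Or.inl hm
    refine twoSided_of_mem_frontier (S := D.carrier \ L) h₁o h₂o hdisj
      (fun z hz => hunion ▸ Or.inl hz) (fun z hz => hunion ▸ Or.inr hz) hm₁ hm₂ hV
      (fun z hz => hVPP ⟨hz.1, hz.2.2⟩) hP hP' (hunion ▸ hPS) (hunion ▸ hP'S)

end Summit.CriticalPhenomena.CardyFormulaZ2.Theorems.CardySelfRefinement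

end
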